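import Mathlib.Combinatorics.SimpleGraph.LineGraph
import Mathlib.Combinatorics.SimpleGraph.Finite
import Mathlib.Data.ZMod.Basic
import Literature.Probability.LatticeModels.LatticeGraph
import Literature.Probability.LatticeModels.TriangularLattice
import HarnessLib

-- provenance: harness21/H21/H21/Prelude/QLatticeAQFT/KagomeLattice.lean @ e53059b (interim HEAD d8f2665); M5 mechanical rewrite
/-!
# The kagome lattice

Trunk: QLatticeAQFT, Part Q (prelude item Q10 `KagomeLattice`, notion `kagome_lattice_graph`).

The kagome lattice is the lattice of corner-sharing triangles obtained as the line graph of the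
honeycomb lattice, equivalently the medial graph of the triangular lattice `𝕋`: its vertices are
the midpoints of the edges of `𝕋`, two of them being adjacent iff the two edges bound a common
triangular face (Savary–Balents, *Quantum spin liquids: a review*, Rep. Prog. Phys. **80** (2017),
016502, §5 (kagome Heisenberg antiferromagnet); Mathlib `SimpleGraph.lineGraph`).

* `KagomeVertex := Site 2 × Fin 3`: the three-site basis on the triangular Bravais lattice
  `Site 2 = ℤ²` of `TriangularLattice.lean`. The vertex `(x, s)` is the midpoint of the edge
  `kagomeEdge (x, s)` of the "up" triangle `{x, x + e₀, x + e₁}` of the cell `x` (the face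
  `(x, 0) : HexVertex`): `s = 0 ↦ {x, x + e₀}`, `s = 1 ↦ {x, x + e₁}`, `s = 2 ↦ {x + e₀, x + e₁}`.
  In coordinates it sits at `x + kagomeOffset s / 2` with `kagomeOffset = (e₀, e₁, e₀ + e₁)`
  (`kagomePos`).
* `kagomeGraph`: the explicit adjacency table (`KagomeAdjRel`): the three sites of the up
  triangle of the cell `x` are pairwise adjacent, and the down triangle of the cell `x` (face
  `(x, 1)`, vertices `x + e₀, x + e₁, x + e₀ + e₁`) consists of `(x, 2)`, `(x + e₀, 1)`,
  `(x + e₁, 0)`, pairwise adjacent. Every vertex lies in exactly one up and one down triangle,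
  hence has `4` neighbours (`degree_kagomeGraph`). `DecidableRel` and `LocallyFinite` have real
  proofs.
* `kagomeGraph_iso_lineGraph_hexGraph`: `kagomeGraph ≃g hexGraph.lineGraph` (sorried).
* Symmetries: translations `KagomeVertex.shift v` (`kagomeGraph_adj_shift_iff`, real) and the
  rotation by `60°` about the origin `kagomeRot60` (induced by `triRot60` on edges of `𝕋`).
* Finite tori: `KagomeTorusVertex L := TorusSite 2 L × Fin 3`, `kagomeTorusGraph L` (the same
  table with cell coordinates read mod `L`), `card_kagomeTorusVertex : card = 3 L²` (real), and the
  projection `KagomeVertex.proj L`.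

Design choices. The adjacency table is written once, for cells `Fin 2 → R` over any ring `R`
(`KagomeAdjRel R`), and instantiated at `R = ℤ` (`Site 2`) and `R = ZMod L` (`TorusSite 2 L`), so
that the torus graph is literally "the same table mod `L`". Graphs are built with
`SimpleGraph.fromRel` (outline §0), which symmetrises the one-sided table and removes the diagonal.
`kagomeRot60` is a plain function on vertices (as `triRot60`); its graph-automorphism property is
the sorried `kagomeGraph_adj_kagomeRot60_iff`.

Mathlib anchors used rather than re-defined: `SimpleGraph.fromRel`, `SimpleGraph.lineGraph`,
`SimpleGraph.Iso`, `SimpleGraph.neighborFinset`/`degree`, `SimpleGraph.LocallyFinite`,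
`Equiv.prodCongr`, `ZMod.card`. Mathlib has no kagome, honeycomb or triangular lattice (grep for
`kagome`, `honeycomb`, `hexagonal lattice` returns nothing); the honeycomb lattice `hexGraph` and
`triGraph`, `triRot60`, `Site.shift`, `Torus.proj` come from the accepted G02 files.
-/

namespace Literature.MathematicalPhysics.QuantumLattice

open Finset Literature.Probability.LatticeModels Literature.Probability.Percolation

/-! ### The adjacency table -/

/-- The one-sided kagome adjacency table on cells `Fin 2 → R` with a three-site basis: within the
up triangle of the cell `x` the sites `(x, s)`, `(x, t)`, `s ≠ t`, are adjacent; the down triangle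
of the cell `x` is `{(x, 2), (x + e₀, 1), (x + e₁, 0)}`, pairwise adjacent. Used at `R = ℤ`
(`kagomeGraph`) and `R = ZMod L` (`kagomeTorusGraph`). (Savary–Balents 2017, §5, Fig. 12.) [cite: SavaryBalents2017, §5  Fig. 12] -/
def KagomeAdjRel (R : Type*) [Ring R] (a b : (Fin 2 → R) × Fin 3) : Prop :=
  (b.1 = a.1 ∧ a.2 ≠ b.2) ∨
    (a.2 = 2 ∧ b.2 = 1 ∧ b.1 = a.1 + Pi.single 0 1) ∨
    (a.2 = 2 ∧ b.2 = 0 ∧ b.1 = a.1 + Pi.single 1 1) ∨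
    (a.2 = 1 ∧ b.2 = 0 ∧ b.1 = a.1 - Pi.single 0 1 + Pi.single 1 1)

/-- The kagome adjacency table is decidable. (Savary–Balents 2017, §5.) [cite: SavaryBalents2017, §5] -/
instance instDecidableKagomeAdjRel (R : Type*) [Ring R] [DecidableEq R]
    (a b : (Fin 2 → R) × Fin 3) : Decidable (KagomeAdjRel R a b) := by
  unfold KagomeAdjRel; infer_instance

/-- The cells `y` that can be adjacent to a site of the cell `x` according to the (symmetrised)
table: `x`, `x ± e₀`, `x ± e₁`, `x ± (e₀ - e₁)`. (Savary–Balents 2017, §5.) [cite: SavaryBalents2017, §5] -/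
def kagomeNeighborCells {R : Type*} [Ring R] [DecidableEq R] (x : Fin 2 → R) :
    Finset (Fin 2 → R) :=
  {x, x + Pi.single 0 1, x + Pi.single 1 1, x - Pi.single 0 1 + Pi.single 1 1,
    x - Pi.single 0 1, x - Pi.single 1 1, x + Pi.single 0 1 - Pi.single 1 1}

/-- If `a ∼ b` in the symmetrised kagome table then the cell of `b` is one of the seven cells
`kagomeNeighborCells a.1`. (Savary–Balents 2017, §5.) [cite: SavaryBalents2017, §5] -/
theorem mem_kagomeNeighborCells_of_kagomeAdjRel {R : Type*} [Ring R] [DecidableEq R]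
    {a b : (Fin 2 → R) × Fin 3} (h : KagomeAdjRel R a b ∨ KagomeAdjRel R b a) :
    b.1 ∈ kagomeNeighborCells a.1 := by
  simp only [kagomeNeighborCells, mem_insert, mem_singleton]
  rcases h with (⟨h, -⟩ | ⟨-, -, h⟩ | ⟨-, -, h⟩ | ⟨-, -, h⟩) |
    (⟨h, -⟩ | ⟨-, -, h⟩ | ⟨-, -, h⟩ | ⟨-, -, h⟩)
  · exact Or.inl h
  · exact Or.inr (Or.inl h)
  · exact Or.inr (Or.inr (Or.inl h))
  · exact Or.inr (Or.inr (Or.inr (Or.inl h)))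
  · exact Or.inl h.symm
  · exact Or.inr (Or.inr (Or.inr (Or.inr (Or.inl (by rw [h, add_sub_cancel_right])))))
  · exact Or.inr (Or.inr (Or.inr (Or.inr (Or.inr (Or.inl (by rw [h, add_sub_cancel_right]))))))
  · refine Or.inr (Or.inr (Or.inr (Or.inr (Or.inr (Or.inr ?_)))))
    rw [h]; abel

/-! ### The kagome lattice on `ℤ²` -/

/-- A vertex of the kagome lattice: a cell `x : Site 2 = ℤ²` of the triangular Bravais lattice and
a sublattice index `s : Fin 3`; `(x, s)` is the midpoint of the edge `kagomeEdge (x, s)` of the up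
triangle of the cell `x`. (Savary–Balents 2017, §5.) [cite: SavaryBalents2017, §5] -/
abbrev KagomeVertex : Type := Site 2 × Fin 3

/-- The sublattice offsets `(e₀, e₁, e₀ + e₁)`: the kagome site `(x, s)` sits at
`x + kagomeOffset s / 2` (in lattice coordinates of `𝕋`; see `kagomePos`).
(Savary–Balents 2017, §5.) [cite: SavaryBalents2017, §5] -/
def kagomeOffset (s : Fin 3) : Site 2 :=
  ![Pi.single 0 1, Pi.single 1 1, Pi.single 0 1 + Pi.single 1 1] s

/-- The position of a kagome site in the equilateral embedding of `𝕋` into `ℂ`: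
`triEmbed x + triEmbed (kagomeOffset s) / 2`, the midpoint of the edge `kagomeEdge (x, s)`.
(Savary–Balents 2017, §5.) [cite: SavaryBalents2017, §5] -/
noncomputable def kagomePos (v : KagomeVertex) : ℂ :=
  triEmbed v.1 + triEmbed (kagomeOffset v.2) / 2

/-- The edge of the triangular lattice whose midpoint is the kagome site `(x, s)`:
`{x, x + e₀}`, `{x, x + e₁}`, `{x + e₀, x + e₁}` for `s = 0, 1, 2`. (Savary–Balents 2017, §5.) [cite: SavaryBalents2017, §5] -/
def kagomeEdge (v : KagomeVertex) : Sym2 (Site 2) :=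
  ![s(v.1, v.1 + Pi.single 0 1), s(v.1, v.1 + Pi.single 1 1),
    s(v.1 + Pi.single 0 1, v.1 + Pi.single 1 1)] v.2

/-- `kagomeEdge v` is an edge of the triangular lattice. (Savary–Balents 2017, §5.) [cite: SavaryBalents2017, §5] -/
theorem kagomeEdge_mem_edgeSet (v : KagomeVertex) : kagomeEdge v ∈ triGraph.edgeSet := by
  obtain ⟨x, s⟩ := v
  fin_cases s <;>
    simp only [kagomeEdge, Matrix.cons_val_zero, Matrix.cons_val_one, Matrix.cons_val,
      Fin.mk_one, Fin.zero_eta, Fin.reduceFinMk, SimpleGraph.mem_edgeSet, triGraph_adj_iff,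
      zdGraph_adj_iff]
  · exact Or.inl ⟨0, Or.inl rfl⟩
  · exact Or.inl ⟨1, Or.inl rfl⟩
  · refine Or.inr (Or.inr ?_)
    ext i; fin_cases i <;> simp [triDiag]

/-- `kagomeEdge` is a bijection onto the edges of `𝕋` (the kagome lattice is the medial lattice
of the triangular lattice). (Savary–Balents 2017, §5.) [cite: SavaryBalents2017, §5] -/
def kagomeEdge_bijective : Prop :=
  Function.Bijective fun v : KagomeVertex => (⟨kagomeEdge v, kagomeEdge_mem_edgeSet v⟩ :
      triGraph.edgeSet)

/-- The kagome lattice: the graph on `KagomeVertex` generated by the table `KagomeAdjRel ℤ`.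
(Savary–Balents 2017, §5.) [cite: SavaryBalents2017, §5] -/
def kagomeGraph : SimpleGraph KagomeVertex := SimpleGraph.fromRel (KagomeAdjRel ℤ)

/-- Adjacency in the kagome lattice, unfolded. (Savary–Balents 2017, §5.) [cite: SavaryBalents2017, §5] -/
theorem kagomeGraph_adj_iff (a b : KagomeVertex) :
    kagomeGraph.Adj a b ↔ a ≠ b ∧ (KagomeAdjRel ℤ a b ∨ KagomeAdjRel ℤ b a) :=
  SimpleGraph.fromRel_adj _ _ _

/-- Adjacency in the kagome lattice is decidable. (Savary–Balents 2017, §5.) [cite: SavaryBalents2017, §5] -/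
instance instDecidableRelKagomeAdj : DecidableRel kagomeGraph.Adj := fun a b =>
  decidable_of_iff _ (kagomeGraph_adj_iff a b).symm

/-- The kagome lattice is locally finite: the neighbours of `(x, s)` have cells among
`kagomeNeighborCells x`. (Savary–Balents 2017, §5.) [cite: SavaryBalents2017, §5] -/
instance instLocallyFiniteKagome : kagomeGraph.LocallyFinite := fun a =>
  Fintype.ofFinset ((kagomeNeighborCells a.1 ×ˢ univ).filter fun b => kagomeGraph.Adj a b) (by
    intro b
    simp only [mem_filter, mem_product, mem_univ, and_true, SimpleGraph.mem_neighborSet,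
      and_iff_right_iff_imp]
    exact fun h => mem_kagomeNeighborCells_of_kagomeAdjRel ((kagomeGraph_adj_iff a b).1 h).2)

/-- Every kagome site has exactly `4` neighbours (two in its up triangle, two in its down
triangle). (Savary–Balents 2017, §5.) [cite: SavaryBalents2017, §5] -/
def degree_kagomeGraph : Prop :=
  ∀ (v : KagomeVertex),
    kagomeGraph.degree v = 4

/-- Two kagome sites are adjacent iff the corresponding edges of `𝕋` are distinct and share a
vertex, i.e. `kagomeEdge` is an isomorphism onto the line graph of `𝕋` restricted to pairs of
edges in a common triangle — equivalently (every two edges of `𝕋` sharing a vertex and lying in a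
common face) adjacency in the medial graph. Stated here in the weaker "share a vertex" direction.
(Savary–Balents 2017, §5.) [cite: SavaryBalents2017, §5] -/
def kagomeEdge_inter_nonempty_of_adj : Prop :=
  ∀ {a b : KagomeVertex} (h : kagomeGraph.Adj a b),
    ((kagomeEdge a : Set (Site 2)) ∩ (kagomeEdge b : Set (Site 2))).Nonempty

/-- The kagome lattice is the line graph of the honeycomb lattice `hexGraph` (vertices of the line
graph = edges of the honeycomb lattice = edges of `𝕋` = kagome sites; two of them are adjacent iff
they bound a common triangular face). (Savary–Balents 2017, §5; Mathlib `SimpleGraph.lineGraph`.) [cite: SavaryBalents2017, §5] -/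
def kagomeGraph_iso_lineGraph_hexGraph : Prop :=
  Nonempty (kagomeGraph ≃g hexGraph.lineGraph)

/-! ### Symmetries -/

/-- Translation of the kagome lattice by a Bravais vector `v ∈ ℤ²`: `(x, s) ↦ (x + v, s)`.
(Savary–Balents 2017, §5.) [cite: SavaryBalents2017, §5] -/
def KagomeVertex.shift (v : Site 2) : KagomeVertex ≃ KagomeVertex :=
  (Site.shift v).prodCongr (Equiv.refl (Fin 3))

/-- `KagomeVertex.shift` in coordinates. (Savary–Balents 2017, §5.) [cite: SavaryBalents2017, §5] -/
@[simp] theorem KagomeVertex.shift_apply (v : Site 2) (a : KagomeVertex) :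
    KagomeVertex.shift v a = (a.1 + v, a.2) := rfl

/-- The adjacency table is translation invariant. (Savary–Balents 2017, §5.) [cite: SavaryBalents2017, §5] -/
theorem kagomeAdjRel_shift_iff {R : Type*} [Ring R] (v : Fin 2 → R)
    (a b : (Fin 2 → R) × Fin 3) :
    KagomeAdjRel R (a.1 + v, a.2) (b.1 + v, b.2) ↔ KagomeAdjRel R a b := by
  simp only [KagomeAdjRel, add_right_comm _ v, sub_eq_add_neg, add_left_inj]

/-- The kagome lattice is translation invariant. (Savary–Balents 2017, §5.) [cite: SavaryBalents2017, §5] -/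
theorem kagomeGraph_adj_shift_iff (v : Site 2) (a b : KagomeVertex) :
    kagomeGraph.Adj (KagomeVertex.shift v a) (KagomeVertex.shift v b) ↔ kagomeGraph.Adj a b := by
  simp only [kagomeGraph_adj_iff, KagomeVertex.shift_apply, kagomeAdjRel_shift_iff, ne_eq,
    Prod.mk.injEq, add_left_inj]
  rw [← Prod.ext_iff]

/-- Rotation of the kagome lattice by `+60°` about the origin of `𝕋` (a hexagon centre of the
kagome lattice), induced by `triRot60 =: R` on the edges of `𝕋`:
`{x, x + e₀} ↦ {Rx, Rx + e₁}`, `{x, x + e₁} ↦ {Rx, Rx + e₁ - e₀}`,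
`{x + e₀, x + e₁} ↦ {Rx + e₁, Rx + e₁ - e₀}`, i.e. `(x, 0) ↦ (Rx, 1)`, `(x, 1) ↦ (Rx - e₀, 2)`,
`(x, 2) ↦ (Rx - e₀ + e₁, 0)`. (Savary–Balents 2017, §5.) [cite: SavaryBalents2017, §5] -/
def kagomeRot60 (v : KagomeVertex) : KagomeVertex :=
  ![(triRot60 v.1, 1), (triRot60 v.1 - Pi.single 0 1, 2),
    (triRot60 v.1 - Pi.single 0 1 + Pi.single 1 1, 0)] v.2

/-- `kagomeRot60` acts on edges of `𝕋` through `triRot60`. (Savary–Balents 2017, §5.) [cite: SavaryBalents2017, §5] -/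
def kagomeEdge_kagomeRot60 : Prop :=
  ∀ (v : KagomeVertex),
    kagomeEdge (kagomeRot60 v) = (kagomeEdge v).map triRot60

/-- `kagomeRot60` is a bijection of the kagome sites. (Savary–Balents 2017, §5.) [cite: SavaryBalents2017, §5] -/
def kagomeRot60_bijective : Prop :=
  Function.Bijective kagomeRot60

/-- `kagomeRot60` is a graph automorphism of the kagome lattice. (Savary–Balents 2017, §5.) [cite: SavaryBalents2017, §5] -/
def kagomeGraph_adj_kagomeRot60_iff : Prop :=
  ∀ (a b : KagomeVertex),
    kagomeGraph.Adj (kagomeRot60 a) (kagomeRot60 b) ↔ kagomeGraph.Adj a b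

/-! ### Finite kagome tori -/

/-- A vertex of the kagome torus with `L × L` unit cells: a cell of the discrete torus
`TorusSite 2 L = (ℤ/Lℤ)²` and a sublattice index. (Savary–Balents 2017, §5.) [cite: SavaryBalents2017, §5] -/
abbrev KagomeTorusVertex (L : ℕ) : Type := TorusSite 2 L × Fin 3

/-- The kagome torus: the graph generated by the same adjacency table with cell coordinates read
mod `L` (`KagomeAdjRel (ZMod L)`). For `L ≤ 2` some of the periodic images coincide and the graph
degenerates (it is still a simple graph). (Savary–Balents 2017, §5.) [cite: SavaryBalents2017, §5] -/
def kagomeTorusGraph (L : ℕ) : SimpleGraph (KagomeTorusVertex L) :=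
  SimpleGraph.fromRel (KagomeAdjRel (ZMod L))

/-- Adjacency on the kagome torus, unfolded. (Savary–Balents 2017, §5.) [cite: SavaryBalents2017, §5] -/
theorem kagomeTorusGraph_adj_iff {L : ℕ} (a b : KagomeTorusVertex L) :
    (kagomeTorusGraph L).Adj a b ↔
      a ≠ b ∧ (KagomeAdjRel (ZMod L) a b ∨ KagomeAdjRel (ZMod L) b a) :=
  SimpleGraph.fromRel_adj _ _ _

/-- Adjacency on the kagome torus is decidable. (Savary–Balents 2017, §5.) [cite: SavaryBalents2017, §5] -/
instance instDecidableRelKagomeTorusAdj {L : ℕ} : DecidableRel (kagomeTorusGraph L).Adj :=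
  fun a b => decidable_of_iff _ (kagomeTorusGraph_adj_iff a b).symm

/-- For `L ≠ 0` the kagome torus is locally finite; this is Mathlib's instance for finite vertex
types with decidable adjacency (recorded as an `example`, not a new instance). -/
example {L : ℕ} [NeZero L] : (kagomeTorusGraph L).LocallyFinite := inferInstance

/-- The kagome torus with `L × L` unit cells has `3 L²` sites. (Savary–Balents 2017, §5.) [cite: SavaryBalents2017, §5] -/
theorem card_kagomeTorusVertex (L : ℕ) [NeZero L] :
    Fintype.card (KagomeTorusVertex L) = 3 * L ^ 2 := by
  simp [Fintype.card_prod, ZMod.card, mul_comm]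

/-- The projection of the infinite kagome lattice onto the kagome torus, reducing the cell
coordinates mod `L` (`Torus.proj`). (Savary–Balents 2017, §5.) [cite: SavaryBalents2017, §5] -/
def KagomeVertex.proj (L : ℕ) (v : KagomeVertex) : KagomeTorusVertex L := (Torus.proj L v.1, v.2)

/-- `KagomeVertex.proj` in coordinates. (Savary–Balents 2017, §5.) [cite: SavaryBalents2017, §5] -/
@[simp] theorem KagomeVertex.proj_apply (L : ℕ) (v : KagomeVertex) :
    KagomeVertex.proj L v = (Torus.proj L v.1, v.2) := rfl

/-- The projection is a graph homomorphism: adjacent kagome sites project to adjacent torus sites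
(for every `L`, since adjacent sites lie on distinct sublattices and the table is preserved by
reduction mod `L`). (Savary–Balents 2017, §5.) [cite: SavaryBalents2017, §5] -/
def kagomeTorusGraph_adj_proj : Prop :=
  ∀ (L : ℕ) {a b : KagomeVertex} (h : kagomeGraph.Adj a b),
    (kagomeTorusGraph L).Adj (KagomeVertex.proj L a) (KagomeVertex.proj L b)

/-! ### The rotation is a bijection

Discharge of the named fact `kagomeRot60_bijective`: the rotation by `-60°`, `kagomeRotNeg60`,
induced by `triRotNeg60` on the edges of `𝕋`, is a two-sided inverse of `kagomeRot60`, so that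
`kagomeRot60` is a permutation of the kagome sites (`kagomeRot60Equiv`). This is the order-`6`
rotation symmetry of the kagome lattice about a hexagon centre (Savary–Balents 2017, §5, Fig. 12);
the computation below is elementary bookkeeping on the three sublattices. -/

/-- Rotation of the kagome lattice by `-60°` about the origin of `𝕋`, induced by
`triRotNeg60 =: R⁻¹` on the edges of `𝕋`; on the three sublattices it reads
`(y, 0) ↦ (R⁻¹ (y - e₁ + e₀), 2)`, `(y, 1) ↦ (R⁻¹ y, 0)`, `(y, 2) ↦ (R⁻¹ (y + e₀), 1)`.
It is the two-sided inverse of `kagomeRot60` (`kagomeRotNeg60_kagomeRot60`,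
`kagomeRot60_kagomeRotNeg60`). (Savary–Balents 2017, §5, Fig. 12.) [cite: SavaryBalents2017, §5  Fig. 12] -/
def kagomeRotNeg60 (v : KagomeVertex) : KagomeVertex :=
  ![(triRotNeg60 (v.1 - Pi.single 1 1 + Pi.single 0 1), 2), (triRotNeg60 v.1, 0),
    (triRotNeg60 (v.1 + Pi.single 0 1), 1)] v.2

/-- `kagomeRotNeg60` is a left inverse of `kagomeRot60`. (Savary–Balents 2017, §5.) [cite: SavaryBalents2017, §5] -/
@[simp] theorem kagomeRotNeg60_kagomeRot60 (v : KagomeVertex) :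
    kagomeRotNeg60 (kagomeRot60 v) = v := by
  obtain ⟨x, s⟩ := v
  fin_cases s <;> simp [kagomeRot60, kagomeRotNeg60]

/-- `kagomeRot60` is a left inverse of `kagomeRotNeg60`. (Savary–Balents 2017, §5.) [cite: SavaryBalents2017, §5] -/
@[simp] theorem kagomeRot60_kagomeRotNeg60 (v : KagomeVertex) :
    kagomeRot60 (kagomeRotNeg60 v) = v := by
  obtain ⟨x, s⟩ := v
  fin_cases s <;> simp [kagomeRot60, kagomeRotNeg60]

/-- The rotation by `+60°` as a permutation of the kagome sites, with inverse the rotation by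
`-60°`. (Savary–Balents 2017, §5, Fig. 12.) [cite: SavaryBalents2017, §5  Fig. 12] -/
def kagomeRot60Equiv : KagomeVertex ≃ KagomeVertex where
  toFun := kagomeRot60
  invFun := kagomeRotNeg60
  left_inv := kagomeRotNeg60_kagomeRot60
  right_inv := kagomeRot60_kagomeRotNeg60

/-- `kagomeRot60Equiv` is `kagomeRot60` as a function. (Savary–Balents 2017, §5.) [cite: SavaryBalents2017, §5] -/
@[simp] theorem kagomeRot60Equiv_apply (v : KagomeVertex) : kagomeRot60Equiv v = kagomeRot60 v :=
  rfl

/-- The inverse of `kagomeRot60Equiv` is `kagomeRotNeg60`. (Savary–Balents 2017, §5.) [cite: SavaryBalents2017, §5] -/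
@[simp] theorem kagomeRot60Equiv_symm_apply (v : KagomeVertex) :
    kagomeRot60Equiv.symm v = kagomeRotNeg60 v :=
  rfl

/-- Discharge of `kagomeRot60_bijective`: the rotation by `+60°` about the origin is a bijection of
the kagome sites, with explicit inverse `kagomeRotNeg60`. (Savary–Balents 2017, §5, Fig. 12: the
kagome lattice is invariant under the rotations of order `6` about hexagon centres.) [cite: SavaryBalents2017, §5  Fig. 12] -/
theorem kagomeRot60_bijective_holds : kagomeRot60_bijective :=
  kagomeRot60Equiv.bijective

end Literature.MathematicalPhysics.QuantumLattice
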